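import Summits.ValiantsHypothesis.ValiantsHypothesis.Theorems.KPlusLogSqLawTropicalBMasterLaw
import Literature.Analysis.Convex.LinearProgrammingDuality

/-!
# Route `KPlusLogSqLaw`, crux `TropicalB` (stmt-ValiantsHypothesis-19771) — CONVERSE OF THE MASTER LAW, part 1:
# no Farkas certificate ⇒ the realisability system of the chain has a rational solution

HONEST FRAMING.  Helper file (seat val-sym-trop-p1 g26, cell `pub-symmetroid`, 2026-08-29; `--supports stmt-ValiantsHypothesis-19771
--as helper`) toward the registered stubs `stub_tropThin` / `stub_tropFat` of `Cruxes/TropicalB/Lines/birth.lean` (crux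
`Summit.ValiantsHypothesis.ValiantsHypothesis.Theses.KPlusLogSqLaw.TropicalB`, route `KPlusLogSqLaw`).  A STRUCTURE theorem valid at every
format; it bounds nothing and asserts nothing about `TropicalB` in its window, `WeakLifting`, the cell's census / DoorA26 / DoorA34,
`MatrixDescartes` (stmt-ValiantsHypothesis-18050) or VP ≠ VNP.

THE POINT.  The tree's MASTER LAW (`MasterLaw.master_law`, this lineage g11) is the easy half of LP duality for the REALISABILITY of a
candidate chain: if `p 0, …, p n` are unique optima of a design at increasing slopes, no non-zero non-negative multiplier system `lam k q`
(chain position `k`, present competitor `q`) is incidence-balanced with non-negative proper prefix slope excesses.  Every candidate-killing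
LP computation of the cell and every exchange law (two-body, multi-exchange, Latin, lex core) is an instance.  This part proves the hard
half over `ℚ` (`exists_rational_solution_of_no_certificate`); part 2 (`…TropicalBMasterLawComplete`) clears denominators, builds the
design, and states the kernel iffs «realisable ⟺ no certificate» and «`TropicalB` ⟺ a bound for certificate-free term sequences».

CONTENTS.  `sum_ite_incidence` (indicator sums over (row, column, class) cells collapse to the `m` incidences of a term),
`exists_nat_mul_integral` (common denominators), `sum_range_sub_pred` (telescoping), and the theorem.  The linear system: unknowns = one
rational per cell (valuation) ⊕ one per chain position (slope) ⊕ one auxiliary; strict rows = one per pair (position `k`, chain-supported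
competitor `q ≠ p k`) reading «weight of `p k` minus weight of `q` at slope `k` is `> 0`», one per step reading «slope increases», and the
invalid pairs' rows read «auxiliary `> 0`».  [folklore: theorems of the alternative (Carver 1921, Motzkin 1936; Schrijver 1986 §7.8 (33),
in the tree as `Literature.Analysis.Convex.LPDuality.carver_strict_feasible`); the packaging is this cell's]
-/

set_option linter.dupNamespace false
set_option autoImplicit false

namespace Summit.ValiantsHypothesis.ValiantsHypothesis.Theorems.KPlusLogSqLaw.MasterLaw

open Summit.ValiantsHypothesis.ValiantsHypothesis.Theorems.MatrixDescartes.Negative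
open Summit.ValiantsHypothesis.ValiantsHypothesis.Theorems.KPlusLogSqLaw.ConvexPosition
open Summit.ValiantsHypothesis.ValiantsHypothesis.Theorems.LacunarySymmetroidMatrixDescartes.TropicalCensus (slope)
open scoped BigOperators
open Finset Matrix

variable {m K : ℕ}

/-! ## 1. Incidence indicators -/

/-- **incidence indicator sums**: summing `f` against the indicator of the incidences of a term `q` over all (row, column, class)
cells gives the sum of `f` over the `m` incidences of `q`. [folklore] -/
theorem sum_ite_incidence (q : Equiv.Perm (Fin m) × (Fin m → Fin K)) (f : Fin m × Fin m × Fin K → ℚ) :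
    ∑ c : Fin m × Fin m × Fin K, (if q.1 c.2.1 = c.1 ∧ q.2 c.2.1 = c.2.2 then f c else 0) =
      ∑ b, f (q.1 b, b, q.2 b) := by
  rw [Fintype.sum_prod_type]
  rw [Finset.sum_comm]
  rw [Fintype.sum_prod_type]
  refine Finset.sum_congr rfl fun b _ => ?_
  dsimp only
  rw [Finset.sum_eq_single (q.2 b)]
  · rw [Finset.sum_eq_single (q.1 b)]
    · simp
    · intro a _ ha; simp [Ne.symm ha]
    · simp
  · intro l _ hl; exact Finset.sum_eq_zero fun a _ => by simp [Ne.symm hl]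
  · simp


/-- clearing denominators: finitely many rationals have a common positive integer multiplier making them all integral. [folklore] -/
theorem exists_nat_mul_integral {κ : Type*} [Fintype κ] (x : κ → ℚ) :
    ∃ N : ℕ, 0 < N ∧ ∀ j, ∃ z : ℤ, (N : ℚ) * x j = z := by
  classical
  refine ⟨∏ j, (x j).den, Finset.prod_pos fun j _ => (x j).den_pos, fun j => ?_⟩
  obtain ⟨c, hc⟩ := Finset.dvd_prod_of_mem (fun j => (x j).den) (Finset.mem_univ j)
  refine ⟨c * (x j).num, ?_⟩
  rw [hc]
  push_cast
  rw [mul_comm ((x j).den : ℚ) c, mul_assoc, mul_comm ((x j).den : ℚ), Rat.mul_den_eq_num]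

/-- telescoping of consecutive differences with the convention `g (-1) = 0`. [folklore] -/
theorem sum_range_sub_pred (g : ℕ → ℚ) (k : ℕ) :
    ∑ i ∈ range (k + 1), (g i - if 1 ≤ i then g (i - 1) else 0) = g k := by
  induction k with
  | zero => simp
  | succ k ih =>
      rw [Finset.sum_range_succ, ih]
      simp only [show 1 ≤ k + 1 from Nat.succ_pos k, if_true, Nat.add_sub_cancel]
      ring


/-! ## 2. Completeness: no certificate ⇒ a design exists -/

/-- **NO CERTIFICATE ⇒ A RATIONAL SOLUTION OF THE REALISABILITY SYSTEM.**  Let `p 0, …, p n` be ANY terms of format `(m, K)` and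
`d` any exponents.  A system of non-negative rational multipliers `lam k q`, supported on pairs with `k ≤ n`, `q ≠ p k` and `q`
CHAIN-SUPPORTED (every incidence `(q.1 b, b, q.2 b)` is an incidence of some `p k'`), is a CERTIFICATE if it is incidence-balanced
(`Σ lam k q · (ev F (p k) − ev F q) = 0` for every weight table `F`) and every proper prefix of its slope excesses
`Σ_{k' ≤ k} Σ_q lam k' q · (S (p k') − S q)`, `k < n`, is `≥ 0`.  If the only certificate is `lam = 0`, then there are RATIONAL
valuations `w` on the cells and rational slopes `t 0 < t 1 < ⋯ < t n` such that at `t k` the term `p k` has strictly larger weight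
`t k · S − W` than every chain-supported `q ≠ p k`.  PROOF: Carver's transposition theorem
(`Literature.Analysis.Convex.LPDuality.carver_strict_feasible`, Schrijver 1986 §7.8 (33)) for the homogeneous strict system in the unknowns
`(w, t)` plus one auxiliary unknown absorbing the rows of invalid pairs; a non-negative dual ray is exactly a certificate (valuation columns
= incidence balance; slope columns = «excess at `k` = step multiplier `k` minus step multiplier `k − 1`», so the prefix sums telescope to
the step multipliers, which are `≥ 0`). [folklore: LP duality; packaging this cell] -/
theorem exists_rational_solution_of_no_certificate (d : Fin K → ℕ) (n : ℕ)
    (p : ℕ → Equiv.Perm (Fin m) × (Fin m → Fin K))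
    (hfree : ∀ lam : ℕ → (Equiv.Perm (Fin m) × (Fin m → Fin K)) → ℚ, (∀ k q, 0 ≤ lam k q) →
      (∀ k q, lam k q ≠ 0 → k ≤ n ∧ q ≠ p k ∧ ∀ b, ∃ k' ≤ n, (p k').1 b = q.1 b ∧ (p k').2 b = q.2 b) →
      (∀ F : Fin m × Fin m × Fin K → ℤ, ∑ k ∈ range (n + 1), ∑ q, lam k q * ((ev F (p k) : ℚ) - (ev F q : ℚ)) = 0) →
      (∀ k < n, 0 ≤ ∑ k' ∈ range (k + 1), ∑ q, lam k' q * ((slope d (p k') : ℚ) - (slope d q : ℚ))) →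
      ∀ k q, lam k q = 0) :
    ∃ (w : Fin m × Fin m × Fin K → ℚ) (t : ℕ → ℚ), (∀ k < n, t k < t (k + 1)) ∧
      ∀ k ≤ n, ∀ q : Equiv.Perm (Fin m) × (Fin m → Fin K), q ≠ p k →
        (∀ b, ∃ k' ≤ n, (p k').1 b = q.1 b ∧ (p k').2 b = q.2 b) →
        t k * (slope d q : ℚ) - ∑ b, w (q.1 b, b, q.2 b) < t k * (slope d (p k) : ℚ) - ∑ b, w ((p k).1 b, b, (p k).2 b) := by
  classical
  -- chain-supported competitors and the valid (chain position, competitor) pairs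
  let Supp : (Equiv.Perm (Fin m) × (Fin m → Fin K)) → Prop := fun q =>
    ∀ b, ∃ k' ≤ n, (p k').1 b = q.1 b ∧ (p k').2 b = q.2 b
  let Valid : Fin (n + 1) × (Equiv.Perm (Fin m) × (Fin m → Fin K)) → Prop := fun kq =>
    kq.2 ≠ p kq.1 ∧ Supp kq.2
  -- incidence indicators and rational slopes
  let χ : (Equiv.Perm (Fin m) × (Fin m → Fin K)) → Fin m × Fin m × Fin K → ℚ := fun q c =>
    if q.1 c.2.1 = c.1 ∧ q.2 c.2.1 = c.2.2 then 1 else 0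
  let S : (Equiv.Perm (Fin m) × (Fin m → Fin K)) → ℚ := fun q => (slope d q : ℚ)
  -- the homogeneous strict system: rows (k, q) [dominance] ⊕ j [θ j < θ (j+1)];
  -- columns: cells [valuations] ⊕ (slopes θ k ⊕ one auxiliary unknown absorbing the invalid rows)
  let A : Matrix ((Fin (n + 1) × (Equiv.Perm (Fin m) × (Fin m → Fin K))) ⊕ Fin n)
      ((Fin m × Fin m × Fin K) ⊕ (Fin (n + 1) ⊕ Unit)) ℚ :=
    Matrix.of fun i j => Sum.elim
      (fun kq => if Valid kq then
          Sum.elim (fun c => χ (p kq.1) c - χ kq.2 c)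
            (Sum.elim (fun k' => if k' = kq.1 then -(S (p kq.1) - S kq.2) else 0) (fun _ => 0)) j
        else Sum.elim (fun _ => 0) (Sum.elim (fun _ => 0) (fun _ => -1)) j)
      (fun jj => Sum.elim (fun _ => (0 : ℚ))
        (Sum.elim (fun k' => (if k' = Fin.castSucc jj then (1 : ℚ) else 0) - (if k' = Fin.succ jj then 1 else 0))
          (fun _ => 0)) j)
      i
  -- incidence sums
  have hχ : ∀ (q : Equiv.Perm (Fin m) × (Fin m → Fin K)) (f : Fin m × Fin m × Fin K → ℚ),
      ∑ c, χ q c * f c = ∑ b, f (q.1 b, b, q.2 b) := by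
    intro q f
    rw [← sum_ite_incidence q f]
    refine Finset.sum_congr rfl fun c _ => ?_
    simp only [χ, boole_mul]
  -- the rows of `A *ᵥ x`
  have hrow_valid : ∀ (x : (Fin m × Fin m × Fin K) ⊕ (Fin (n + 1) ⊕ Unit) → ℚ)
      (kq : Fin (n + 1) × (Equiv.Perm (Fin m) × (Fin m → Fin K))), Valid kq →
      (A *ᵥ x) (Sum.inl kq) =
        (∑ b, x (Sum.inl ((p kq.1).1 b, b, (p kq.1).2 b)) - ∑ b, x (Sum.inl (kq.2.1 b, b, kq.2.2 b))) -
          (S (p kq.1) - S kq.2) * x (Sum.inr (Sum.inl kq.1)) := by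
    intro x kq hv
    simp only [A, mulVec, dotProduct, Matrix.of_apply, Sum.elim_inl, if_pos hv, Fintype.sum_sum_type, Sum.elim_inr,
      Fintype.univ_punit, sum_singleton, zero_mul, add_zero]
    rw [Finset.sum_congr rfl fun c _ => sub_mul (χ (p kq.1) c) (χ kq.2 c) (x (Sum.inl c)), Finset.sum_sub_distrib,
      hχ, hχ]
    simp only [ite_mul, neg_mul, zero_mul, Finset.sum_ite_eq', Finset.mem_univ, if_true]
    ring
  have hrow_step : ∀ (x : (Fin m × Fin m × Fin K) ⊕ (Fin (n + 1) ⊕ Unit) → ℚ) (jj : Fin n),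
      (A *ᵥ x) (Sum.inr jj) = x (Sum.inr (Sum.inl (Fin.castSucc jj))) - x (Sum.inr (Sum.inl (Fin.succ jj))) := by
    intro x jj
    simp only [A, mulVec, dotProduct, Matrix.of_apply, Sum.elim_inr, Sum.elim_inl, Fintype.sum_sum_type,
      Fintype.univ_punit, zero_mul, add_zero, sum_const_zero, zero_add, sub_mul, ite_mul, one_mul,
      Finset.sum_sub_distrib, Finset.sum_ite_eq', Finset.mem_univ, if_true]
  -- STEP 1: the strict system is feasible over ℚ (Carver: no non-zero non-negative dual ray)
  have hfeas : ∃ x : (Fin m × Fin m × Fin K) ⊕ (Fin (n + 1) ⊕ Unit) → ℚ, ∀ i, (A *ᵥ x) i < 0 := by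
    have hC := (Literature.Analysis.Convex.LPDuality.carver_strict_feasible A 0).mpr
    simp only [Pi.zero_apply] at hC
    refine hC fun y hy hyA _ => ?_
    -- the multipliers read off `y`
    let lam : ℕ → (Equiv.Perm (Fin m) × (Fin m → Fin K)) → ℚ := fun k q =>
      if h : k < n + 1 then (if Valid (⟨k, h⟩, q) then y (Sum.inl (⟨k, h⟩, q)) else 0) else 0
    have hlamFin : ∀ (k : Fin (n + 1)) q, lam k q = if Valid (k, q) then y (Sum.inl (k, q)) else 0 := by
      intro k q
      simp only [lam, dif_pos k.isLt, Fin.eta]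
    have hlam0 : ∀ k q, 0 ≤ lam k q := by
      intro k q
      simp only [lam]
      split_ifs
      · exact hy _
      · exact le_rfl
      · exact le_rfl
    have hlamsupp : ∀ k q, lam k q ≠ 0 → k ≤ n ∧ q ≠ p k ∧ ∀ b, ∃ k' ≤ n, (p k').1 b = q.1 b ∧ (p k').2 b = q.2 b := by
      intro k q h
      simp only [lam] at h
      split_ifs at h with h1 h2
      · exact ⟨by omega, h2.1, h2.2⟩
      · exact absurd rfl h
      · exact absurd rfl h
    -- the cell columns of `y ᵥ* A = 0`: incidence balance
    have hcol_cell : ∀ c : Fin m × Fin m × Fin K,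
        ∑ kq : Fin (n + 1) × (Equiv.Perm (Fin m) × (Fin m → Fin K)),
          lam kq.1 kq.2 * (χ (p kq.1) c - χ kq.2 c) = 0 := by
      intro c
      have h := congrFun hyA (Sum.inl c)
      simp only [vecMul, dotProduct, Pi.zero_apply, Fintype.sum_sum_type, A, Matrix.of_apply, Sum.elim_inl,
        Sum.elim_inr, mul_zero, sum_const_zero, add_zero] at h
      rw [← h]
      refine Finset.sum_congr rfl fun kq _ => ?_
      rw [hlamFin]
      split_ifs with hv
      · rfl
      · simp
    have hbal : ∀ F : Fin m × Fin m × Fin K → ℤ,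
        ∑ k ∈ range (n + 1), ∑ q, lam k q * ((ev F (p k) : ℚ) - (ev F q : ℚ)) = 0 := by
      intro F
      rw [← Fin.sum_univ_eq_sum_range (fun k => ∑ q, lam k q * ((ev F (p k) : ℚ) - (ev F q : ℚ))) (n + 1)]
      have hev : ∀ q : Equiv.Perm (Fin m) × (Fin m → Fin K), (ev F q : ℚ) = ∑ c, χ q c * (F c : ℚ) := by
        intro q
        rw [hχ q (fun c => (F c : ℚ)), ev_eq_sum]
        push_cast
        rfl
      calc ∑ k : Fin (n + 1), ∑ q, lam k q * ((ev F (p k) : ℚ) - (ev F q : ℚ))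
          = ∑ k : Fin (n + 1), ∑ q, ∑ c, (F c : ℚ) * (lam k q * (χ (p k) c - χ q c)) := by
            refine Finset.sum_congr rfl fun k _ => Finset.sum_congr rfl fun q _ => ?_
            rw [hev, hev, ← Finset.sum_sub_distrib, Finset.mul_sum]
            refine Finset.sum_congr rfl fun c _ => ?_
            ring
        _ = ∑ k : Fin (n + 1), ∑ c, ∑ q, (F c : ℚ) * (lam k q * (χ (p k) c - χ q c)) :=
            Finset.sum_congr rfl fun k _ => Finset.sum_comm
        _ = ∑ c, ∑ k : Fin (n + 1), ∑ q, (F c : ℚ) * (lam k q * (χ (p k) c - χ q c)) := Finset.sum_comm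
        _ = ∑ c, (F c : ℚ) * ∑ kq : Fin (n + 1) × (Equiv.Perm (Fin m) × (Fin m → Fin K)),
              lam kq.1 kq.2 * (χ (p kq.1) c - χ kq.2 c) := by
            refine Finset.sum_congr rfl fun c _ => ?_
            rw [Finset.mul_sum, Fintype.sum_prod_type]
        _ = 0 := by simp [hcol_cell]
    -- the slope columns of `y ᵥ* A = 0`: the slope excess at position `k` is a difference of consecutive step multipliers
    let yN : ℕ → ℚ := fun i => if h : i < n then y (Sum.inr ⟨i, h⟩) else 0
    have hexcess : ∀ k : Fin (n + 1),
        ∑ q, lam k q * (S (p k) - S q) = yN k - (if 1 ≤ (k : ℕ) then yN (k - 1) else 0) := by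
      intro k
      have h := congrFun hyA (Sum.inr (Sum.inl k))
      simp only [vecMul, dotProduct, Pi.zero_apply, Fintype.sum_sum_type, A, Matrix.of_apply, Sum.elim_inl,
        Sum.elim_inr] at h
      -- h : (Σ_{kq} y kq * (if valid then (if k = kq.1 then -(S..) else 0) else 0)) + Σ_j y_j * ([k = cs j] - [k = succ j]) = 0
      have h1 : ∑ kq : Fin (n + 1) × (Equiv.Perm (Fin m) × (Fin m → Fin K)),
          y (Sum.inl kq) * (if Valid kq then (if k = kq.1 then -(S (p kq.1) - S kq.2) else 0) else 0) =
          -∑ q, lam k q * (S (p k) - S q) := by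
        rw [Fintype.sum_prod_type, Finset.sum_eq_single k]
        · rw [← Finset.sum_neg_distrib]
          refine Finset.sum_congr rfl fun q _ => ?_
          rw [hlamFin]
          by_cases hv : Valid (k, q)
          · rw [if_pos hv, if_pos hv, if_pos rfl]; ring
          · rw [if_neg hv, if_neg hv]; ring
        · intro k' _ hk'
          refine Finset.sum_eq_zero fun q _ => ?_
          have hne : ¬ k = (k', q).1 := fun h => hk' h.symm
          rw [if_neg hne, ite_self, mul_zero]
        · intro h; exact absurd (Finset.mem_univ k) h
      have h2a : ∑ jj : Fin n, (if k = Fin.castSucc jj then y (Sum.inr jj) else 0) = yN k := by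
        by_cases hk : (k : ℕ) < n
        · have hval : ∀ jj : Fin n, k = Fin.castSucc jj ↔ jj = ⟨k, hk⟩ := by
            intro jj; constructor
            · intro h; ext; simp [h]
            · intro h; subst h; ext; simp
          simp only [hval, Finset.sum_ite_eq', Finset.mem_univ, if_true, yN, dif_pos hk]
        · rw [Finset.sum_eq_zero]
          · simp [yN, hk]
          · intro jj _
            rw [if_neg]
            intro h
            apply hk
            rw [h, Fin.val_castSucc]; exact jj.isLt
      have h2b : ∑ jj : Fin n, (if k = Fin.succ jj then y (Sum.inr jj) else 0) =
          if 1 ≤ (k : ℕ) then yN (k - 1) else 0 := by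
        by_cases hk : 1 ≤ (k : ℕ)
        · have hlt : (k : ℕ) - 1 < n := by have := k.isLt; omega
          have hval : ∀ jj : Fin n, k = Fin.succ jj ↔ jj = ⟨(k : ℕ) - 1, hlt⟩ := by
            intro jj; constructor
            · intro h; ext; simp [h]
            · intro h; subst h; ext; simp; omega
          simp only [hval, Finset.sum_ite_eq', Finset.mem_univ, if_true, yN, dif_pos hlt, if_pos hk]
        · rw [if_neg hk, Finset.sum_eq_zero]
          intro jj _
          rw [if_neg]
          intro h
          apply hk
          rw [h, Fin.val_succ]; omega
      have h2 : ∑ jj : Fin n, y (Sum.inr jj) *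
          ((if k = Fin.castSucc jj then (1 : ℚ) else 0) - (if k = Fin.succ jj then 1 else 0)) =
          yN k - (if 1 ≤ (k : ℕ) then yN (k - 1) else 0) := by
        rw [← h2a, ← h2b, ← Finset.sum_sub_distrib]
        refine Finset.sum_congr rfl fun jj _ => ?_
        split_ifs <;> ring
      rw [h1, h2] at h
      linarith
    -- prefix sums telescope to the step multipliers, which are `≥ 0`
    have hprefixN : ∀ k < n + 1, ∑ k' ∈ range (k + 1), ∑ q, lam k' q * ((slope d (p k') : ℚ) - (slope d q : ℚ)) = yN k := by
      intro k hk
      rw [← sum_range_sub_pred yN k]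
      refine Finset.sum_congr rfl fun i hi => ?_
      rw [Finset.mem_range] at hi
      have := hexcess ⟨i, by omega⟩
      exact this
    have hpre : ∀ k < n, 0 ≤ ∑ k' ∈ range (k + 1), ∑ q, lam k' q * ((slope d (p k') : ℚ) - (slope d q : ℚ)) := by
      intro k hk
      rw [hprefixN k (by omega)]
      simp only [yN, dif_pos hk]
      exact hy _
    -- no certificate: all multipliers vanish
    have hzero := hfree lam hlam0 hlamsupp hbal hpre
    -- hence `y = 0`
    have hy_valid : ∀ kq : Fin (n + 1) × (Equiv.Perm (Fin m) × (Fin m → Fin K)), Valid kq → y (Sum.inl kq) = 0 := by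
      intro kq hv
      have h := hzero kq.1 kq.2
      rw [hlamFin, if_pos hv] at h
      exact h
    have hy_invalid : ∀ kq : Fin (n + 1) × (Equiv.Perm (Fin m) × (Fin m → Fin K)), ¬ Valid kq → y (Sum.inl kq) = 0 := by
      have h := congrFun hyA (Sum.inr (Sum.inr ()))
      simp only [vecMul, dotProduct, Pi.zero_apply, Fintype.sum_sum_type, A, Matrix.of_apply, Sum.elim_inl,
        Sum.elim_inr, mul_zero, sum_const_zero, add_zero] at h
      -- h : Σ_{kq} y kq * (if Valid kq then 0 else -1) = 0
      have h' : ∑ kq : Fin (n + 1) × (Equiv.Perm (Fin m) × (Fin m → Fin K)),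
          (if Valid kq then 0 else y (Sum.inl kq)) = 0 := by
        have h'' : ∑ kq : Fin (n + 1) × (Equiv.Perm (Fin m) × (Fin m → Fin K)),
            y (Sum.inl kq) * (if Valid kq then (0 : ℚ) else -1) =
            -∑ kq : Fin (n + 1) × (Equiv.Perm (Fin m) × (Fin m → Fin K)), (if Valid kq then 0 else y (Sum.inl kq)) := by
          rw [← Finset.sum_neg_distrib]
          refine Finset.sum_congr rfl fun kq _ => ?_
          split_ifs <;> ring
        rw [h''] at h
        linarith
      intro kq hv
      have hle := (Finset.sum_eq_zero_iff_of_nonneg fun kq _ => ?_).mp h' kq (Finset.mem_univ _)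
      · simpa [hv] using hle
      · split_ifs
        · exact le_rfl
        · exact hy _
    have hyN : ∀ i, yN i = 0 := by
      intro i
      by_cases hi : i < n + 1
      · rw [← hprefixN i hi]
        refine Finset.sum_eq_zero fun k' _ => Finset.sum_eq_zero fun q _ => ?_
        rw [hzero, zero_mul]
      · simp only [yN, dif_neg (show ¬ i < n by omega)]
    funext i
    rcases i with kq | jj
    · by_cases hv : Valid kq
      · exact hy_valid kq hv
      · exact hy_invalid kq hv
    · have := hyN jj
      simp only [yN, dif_pos jj.isLt, Fin.eta] at this
      exact this
  -- STEP 2: read off the rational solution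
  obtain ⟨x, hx⟩ := hfeas
  refine ⟨fun c => x (Sum.inl c), fun i => if h : i < n + 1 then x (Sum.inr (Sum.inl ⟨i, h⟩)) else 0,
    fun k hk => ?_, fun k hk q hne hsupp => ?_⟩
  · have h := hx (Sum.inr ⟨k, hk⟩)
    rw [hrow_step] at h
    dsimp only
    rw [dif_pos (show k < n + 1 by omega), dif_pos (show k + 1 < n + 1 by omega)]
    simp only [Fin.castSucc_mk, Fin.succ_mk] at h
    linarith
  · have hkFin : k < n + 1 := by omega
    have hvalid : Valid (⟨k, hkFin⟩, q) := ⟨hne, hsupp⟩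
    have h := hx (Sum.inl (⟨k, hkFin⟩, q))
    rw [hrow_valid x _ hvalid] at h
    dsimp only
    rw [dif_pos hkFin]
    simp only [S] at h
    linarith

end Summit.ValiantsHypothesis.ValiantsHypothesis.Theorems.KPlusLogSqLaw.MasterLaw
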